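import Literature.Analysis.FluidPDE.SwirlMaximumPrinciple
import Literature.Analysis.FluidPDE.TaoLocalisationHolds
import Literature.Analysis.FluidPDE.TaoFiniteEnergyLerayHopf
import Literature.Analysis.FluidPDE.NSWeakStrongUniquenessHolds
import Literature.Analysis.FluidPDE.NSCriticalClosureTao
import Literature.Analysis.FluidPDE.TaoClassSymmetry
import HarnessLib

/-!
# A classical Leray–Hopf solution from a rapidly decaying axisymmetric datum is bounded and
# axisymmetric on every closed sub-slab
# (support item `SwirlSupStrictDecrease`, route `SwirlThreshold`, stmt-NavierStokesRegularity-2004)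

Helper file for the proof of `SwirlSupStrictDecrease`.  Let `(u, p)` be a classical solution of
the unforced Navier–Stokes system (`ν > 0`) on `[0, T) × ℝ³` which is a Leray–Hopf weak solution
on `[0, T)` from its datum `u(0)`, the datum having rapidly decaying derivatives and being
axisymmetric.  Then on every closed sub-slab `[0, T'] × ℝ³`, `0 < T' < T`
(`regular_of_classical_lerayHopf`):

* `(u, p)` is a classical solution on `[0, T']` (restriction of the time set);
* the velocity is bounded: the energy inequality of the Leray–Hopf structure bounds
  `sup_t ∫|u(t)|²` by `∫|u(0)|²` (`lintegral_sq_le_of_isLerayHopfOn`), so by Tao's Cor. 11.1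
  (the tree's theorem `tao2011_hasBoundedSobolevNormsOn_holds`) all Sobolev norms of `u` are
  bounded on `[0, T']`, and `H² ⊂ C_B` (`exists_forall_norm_le_of_hasBoundedSobolevNormsOn`);
* every slice `u(t)`, `t ∈ [0, T']`, is axisymmetric: for a rotation `R` about the axis the
  conjugate `R u(t, R⁻¹x)` is again a classical solution (`conj_linearIsometryEquiv`) with the
  same finite energy and the same datum, both are Leray–Hopf on `[0, T')`
  (`isLerayHopfOn_of_finiteEnergy`, Tao 2013 Lemma 8.1) and the bounded one lies in the Serrin
  class `L^∞_t L^∞_x`, so they agree by the Prodi–Serrin weak–strong uniqueness theorem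
  (`weak_strong_uniqueness_holds`) a.e., hence everywhere by continuity.
-/

noncomputable section

-- the summit and its single problem share the name (D-0017 nested layout)
set_option linter.dupNamespace false

open Set Function Filter Topology MeasureTheory InnerProductSpace Metric WithLp
open scoped RealInnerProductSpace ContDiff NNReal ENNReal

namespace Summit.NavierStokesRegularity.NavierStokesRegularity.Theorems.SwirlSupStrictDecrease

open Literature.Analysis.FluidPDE

section

variable {ν T : ℝ} {u : ℝ → (EuclideanSpace ℝ (Fin 3)) → (EuclideanSpace ℝ (Fin 3))}
  {p : ℝ → (EuclideanSpace ℝ (Fin 3)) → ℝ}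

/-- **The energy bound of a Leray–Hopf solution of the unforced system**: `∫|u(t)|² ≤ ∫|u₀|²`
for every `t ∈ [0, T]`, in the form `∫⁻ ‖u t‖ₑ² ≤ ofReal (2 E(u₀))` (the energy inequality
from `s = 0`, the dissipation being nonnegative). [folklore] -/
theorem lintegral_sq_le_of_isLerayHopfOn {u₀ : (EuclideanSpace ℝ (Fin 3)) → (EuclideanSpace ℝ (Fin 3))}
    (hLH : IsLerayHopfOn T ν 0 u₀ u) (hν : 0 ≤ ν) :
    ∀ t ∈ Icc 0 T, ∫⁻ x, ‖u t x‖ₑ ^ 2 ≤ ENNReal.ofReal (2 * VectorCalculus.kineticEnergy u₀) := by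
  intro t ht
  obtain ⟨G, -, -, h0, -⟩ := hLH.weakGrad_energy
  have h1 := h0 t ht
  have hforce : ∫ τ in (0 : ℝ)..t, ∫ x, ⟪(0 : ℝ → (EuclideanSpace ℝ (Fin 3)) → (EuclideanSpace ℝ (Fin 3))) τ x, u τ x⟫ = 0 := by
    simp
  rw [hforce, add_zero] at h1
  have h2 : 0 ≤ ν * (∫⁻ τ in Ioo 0 t, ∫⁻ x, ENNReal.ofReal (frobeniusNormSq (G τ x))).toReal :=
    mul_nonneg hν ENNReal.toReal_nonneg
  have h3 : VectorCalculus.kineticEnergy (u t) ≤ VectorCalculus.kineticEnergy u₀ := by linarith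
  have h4 : eEnergy (u t) = ENNReal.ofReal (2 * VectorCalculus.kineticEnergy (u t)) := hLH.eEnergy_eq ht
  calc ∫⁻ x, ‖u t x‖ₑ ^ 2 = eEnergy (u t) := rfl
    _ = ENNReal.ofReal (2 * VectorCalculus.kineticEnergy (u t)) := h4
    _ ≤ ENNReal.ofReal (2 * VectorCalculus.kineticEnergy u₀) := ENNReal.ofReal_le_ofReal (by linarith)

/-- **Serrin class of a bounded classical field**: a jointly smooth velocity bounded by `V` on
`[0, T] × ℝ³` lies in `L^∞(0, T; L^∞)` (`MemLqLp ∞ ∞`). [folklore] -/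
theorem memLqLp_top_top_of_bound (hcl : IsClassicalNSSolutionOn (Icc 0 T) ν 0 u p) {V : ℝ}
    (hV : ∀ t ∈ Icc 0 T, ∀ x, ‖u t x‖ ≤ V) : MemLqLp ∞ ∞ u (Ioo 0 T) := by
  have hslice : ∀ t ∈ Ioo 0 T, eLpNorm (u t) ∞ volume ≤ ENNReal.ofReal V := fun t ht => by
    rw [eLpNorm_exponent_top]
    exact eLpNormEssSup_le_of_ae_bound (Eventually.of_forall (hV t (Ioo_subset_Icc_self ht)))
  have hV0 : ∀ t ∈ Ioo 0 T, 0 ≤ V := fun t ht => (norm_nonneg _).trans (hV t (Ioo_subset_Icc_self ht) 0)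
  refine ⟨?_, ?_⟩
  · refine (ae_restrict_iff' measurableSet_Ioo).2 (Eventually.of_forall fun t ht => ?_)
    exact memLp_top_of_bound (hcl.contDiff_velocity (Ioo_subset_Icc_self ht)).continuous.aestronglyMeasurable
      V (Eventually.of_forall (hV t (Ioo_subset_Icc_self ht)))
  · rw [eLqLpNorm, eLpNorm_exponent_top]
    refine eLpNormEssSup_lt_top_of_ae_bound (C := V) ?_
    refine (ae_restrict_iff' measurableSet_Ioo).2 (Eventually.of_forall fun t ht => ?_)
    rw [Real.norm_of_nonneg ENNReal.toReal_nonneg]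
    exact ENNReal.toReal_le_of_le_ofReal (hV0 t ht) (hslice t ht)

/-- **Symmetry from uniqueness.** Let `(u, p)` be a classical solution of the unforced system
(`ν > 0`) on `[0, T] × ℝ³`, `T > 0`, with bounded velocity and finite energy, and let `R` be a
linear isometry of `ℝ³` fixing the datum, `R u₀(R⁻¹x) = u₀(x)`. Then `R u(t, R⁻¹x) = u(t, x)`
on `[0, T] × ℝ³`: both sides are finite energy classical solutions from `u₀`, hence Leray–Hopf
solutions on `[0, T)` (`isLerayHopfOn_of_finiteEnergy`), and the bounded one is in the Serrin
class `L^∞L^∞`, so the Prodi–Serrin weak–strong uniqueness theorem (`weak_strong_uniqueness_holds`)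
identifies them a.e. on every slice of `(0, T]`, hence everywhere by continuity. [folklore] -/
theorem conj_eq_of_datum (hν : 0 < ν) (hT : 0 < T) (hcl : IsClassicalNSSolutionOn (Icc 0 T) ν 0 u p)
    {V : ℝ} (hV : ∀ t ∈ Icc 0 T, ∀ x, ‖u t x‖ ≤ V)
    {A : ℝ≥0∞} (hA : A < ⊤) (hE : ∀ t ∈ Icc 0 T, ∫⁻ x, ‖u t x‖ₑ ^ 2 ≤ A)
    (R : (EuclideanSpace ℝ (Fin 3)) ≃ₗᵢ[ℝ] (EuclideanSpace ℝ (Fin 3)))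
    (h0 : ∀ x, R (u 0 (R.symm x)) = u 0 x) :
    ∀ t ∈ Icc 0 T, ∀ x, R (u t (R.symm x)) = u t x := by
  have hU : UniqueDiffOn ℝ (Icc 0 T) := uniqueDiffOn_Icc hT
  -- the conjugate solution
  have hv' := hcl.conj_linearIsometryEquiv R hU
  have hz : (fun (t : ℝ) (x : EuclideanSpace ℝ (Fin 3)) =>
      R ((0 : ℝ → (EuclideanSpace ℝ (Fin 3)) → (EuclideanSpace ℝ (Fin 3))) t (R.symm x))) = 0 := by
    funext t x; simp
  rw [hz] at hv'
  -- its energy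
  have hEv : ∀ t ∈ Icc 0 T, ∫⁻ x, ‖R (u t (R.symm x))‖ₑ ^ 2 ≤ A := by
    intro t ht
    have h1 : ∀ x, ‖R (u t (R.symm x))‖ₑ = ‖u t (R.symm x)‖ₑ := fun x => by
      rw [← ofReal_norm, ← ofReal_norm, LinearIsometryEquiv.norm_map]
    simp_rw [h1]
    rw [lintegral_comp_linearIsometryEquiv R.symm (fun x => ‖u t x‖ₑ ^ 2)]
    exact hE t ht
  -- both are Leray–Hopf on `[0, T)` from `u 0`
  have hLHu : IsLerayHopfOn T ν 0 (u 0) u := (isLerayHopfOn_of_finiteEnergy hcl hν hT ⟨A, hA, hE⟩).1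
  have hLHv : IsLerayHopfOn T ν 0 (u 0) (fun t x => R (u t (R.symm x))) := by
    have h := (isLerayHopfOn_of_finiteEnergy hv' hν hT ⟨A, hA, hEv⟩).1
    have h0' : (fun x => R (u 0 (R.symm x))) = u 0 := funext h0
    rw [h0'] at h
    exact h
  -- weak–strong uniqueness in the Serrin class `L^∞ L^∞`
  have hS : MemLqLp ∞ ∞ u (Ioo 0 T) := memLqLp_top_top_of_bound hcl hV
  have hws := weak_strong_uniqueness_holds hν hT hLHu (q := ∞) (r := ∞) (by simp)
    (by simp [ENNReal.div_top]) hS hLHv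
  intro t ht x
  rcases eq_or_lt_of_le ht.1 with h | h
  · rw [← h]; exact h0 x
  · have hae := hws t ⟨h, ht.2⟩
    have hcu : Continuous (u t) := (hcl.contDiff_velocity ht).continuous
    have hcv : Continuous (fun x => R (u t (R.symm x))) := (hv'.contDiff_velocity ht).continuous
    have heq := (Continuous.ae_eq_iff_eq volume hcv hcu).1 hae
    exact congrFun heq x

end

/-- **Bounded velocity and axisymmetric slices of a classical Leray–Hopf solution from a rapidly
decaying axisymmetric datum.** Let `(u, p)` be a classical solution of the unforced Navier–Stokes
system (`ν > 0`) on `[0, T) × ℝ³`, Leray–Hopf on `[0, T)` from `u(0)`, with `u(0)` rapidly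
decaying and axisymmetric. Then for `0 < T' < T`: `(u, p)` is classical on the closed slab
`[0, T']`, the velocity is bounded there (Tao 2013, Cor. 11.1, `tao2011_hasBoundedSobolevNormsOn_holds`,
with the energy bound of the Leray–Hopf structure and `H² ⊂ C_B`), and every slice `u(t)`,
`t ∈ [0, T']`, is axisymmetric (`conj_eq_of_datum` for the rotations about the axis). -/
theorem regular_of_classical_lerayHopf {ν T : ℝ} (hν : 0 < ν)
    {u : ℝ → (EuclideanSpace ℝ (Fin 3)) → (EuclideanSpace ℝ (Fin 3))} {p : ℝ → (EuclideanSpace ℝ (Fin 3)) → ℝ}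
    (hcl : IsClassicalNSSolutionOn (Ico 0 T) ν 0 u p) (hLH : IsLerayHopfOn T ν 0 (u 0) u)
    (hdec : HasRapidSpatialDecay (u 0)) (haxi : IsAxisymmetric (u 0)) {T' : ℝ} (hT'0 : 0 < T')
    (hT'T : T' < T) :
    IsClassicalNSSolutionOn (Icc 0 T') ν 0 u p ∧
    (∃ V : ℝ, 0 ≤ V ∧ ∀ t ∈ Icc 0 T', ∀ x, ‖u t x‖ ≤ V) ∧
    (∀ t ∈ Icc 0 T', IsAxisymmetric (u t)) := by
  have hcl' : IsClassicalNSSolutionOn (Icc 0 T') ν 0 u p :=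
    hcl.mono (Icc_subset_Ico_right hT'T) (uniqueDiffOn_Icc hT'0)
  -- finite energy on `[0, T']`
  have hE : ∀ t ∈ Icc 0 T', ∫⁻ x, ‖u t x‖ₑ ^ 2 ≤ ENNReal.ofReal (2 * VectorCalculus.kineticEnergy (u 0)) :=
    fun t ht => lintegral_sq_le_of_isLerayHopfOn hLH hν.le t ⟨ht.1, ht.2.trans hT'T.le⟩
  -- Tao's Cor. 11.1: all Sobolev norms are bounded, so the velocity is bounded
  have hSob : HasBoundedSobolevNormsOn (Icc 0 T') u :=
    tao2011_hasBoundedSobolevNormsOn_holds hν hT'0 hcl'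
      ⟨(2 * VectorCalculus.kineticEnergy (u 0)).toNNReal, hE⟩ hdec
  obtain ⟨V, hV0, hV⟩ := exists_forall_norm_le_of_hasBoundedSobolevNormsOn hcl' hSob
  refine ⟨hcl', ⟨V, hV0, hV⟩, fun t ht θ x => ?_⟩
  -- axisymmetry of the slices, by uniqueness
  have h0 : ∀ y, rotZLIE θ (u 0 ((rotZLIE θ).symm y)) = u 0 y := fun y => by
    rw [rotZLIE_apply, rotZLIE_symm_apply]
    exact haxi.rotZ_apply_rotZ_neg θ y
  have key := conj_eq_of_datum hν hT'0 hcl' hV ENNReal.ofReal_lt_top hE (rotZLIE θ) h0 t ht (rotZ θ x)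
  rw [rotZLIE_apply, rotZLIE_symm_apply, ← rotZ_add, neg_add_cancel, rotZ_zero] at key
  exact key.symm

end Summit.NavierStokesRegularity.NavierStokesRegularity.Theorems.SwirlSupStrictDecrease

end
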